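import Literature.Topology.FourManifolds.ReducibleTrisectionSplitting
import Literature.Topology.FourManifolds.TrisectionShrink
import Literature.Topology.FourManifolds.WeaklyReducibleTrisectionsNaturality
import Literature.Topology.FourManifolds.ConnectedSumSphereIdentity
import Literature.Topology.FourManifolds.HomotopyS4CompactProofs
import HarnessLib

/-!
# The splitting facts for reducible trisections: universe bookkeeping (PROVED)

Topic `Literature/Topology/FourManifolds`, proofs companion of `ReducibleTrisectionSplitting.lean`
(the two named facts `Trisection.isConnectedSum_of_reducing_separating` and
`Trisection.isConnectedSum_circleProd_of_reducing_nonseparating`, Aranda–Zupan 2025 §2 p. 6 /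
Meier–Schirmer–Zupan 2016 Prop. 3.5; NOT discharged — see that file's § Status).

Both facts quantify over a trisected closed smooth 4-manifold `X : Type u` AND conclude with the
existence of summands `X₁, X₂ : Type u` (same universe).  A discharge must hold at every
universe while any proof builds its summands by cutting and capping concrete models in `Type 0`.
Here the facts are shown to be universe-free: `…_of_univ : fact.{v} → fact.{u}` for all `u v`,
hence `…_univ_iff`.  Hypotheses move DOWN/ACROSS to the small copy `Shrink.{v} X`
(`small_of_secondCountableTopology`; transported smooth structure and orientation,
`ManifoldShrink.lean`; trisection with its pieces shrunk, `IsGKTrisection.preimage_diffeomorph`,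
`TrisectionShrink.lean`; reducing curve, its essentiality, its three compressing discs and its
(non-)separation, `WeaklyReducibleTrisectionsNaturality.lean` and
`Trisection.not_exists_disc_image_diffeomorph` below); the summands produced in `Type v` move to
`Shrink.{u} Xᵢ : Type u` the same way, and the connected-sum relation is carried along the three
diffeomorphisms (`IsConnectedSum.of_diffeomorph`, `.of_diffeomorph_left`, `.of_diffeomorph_right`,
`ConnectedSumSpheres.lean`, `ConnectedSumSphereIdentity.lean`; the `S¹ × S³` summand of the
non-separating case is Mathlib's `Circle × 𝕊³ : Type`, fixed).  Everything here is proved; no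
named fact is introduced.

## References

* R. Aranda, A. Zupan, *Manifolds with weakly reducible genus-three trisections are standard*,
  arXiv:2503.04607 (2025), §2 p. 6. [ArandaZupan2025]
* J. Meier, T. Schirmer, A. Zupan, *Classification of trisections and the Generalized Property R
  Conjecture*, Proc. AMS 144 (2016), §3, Prop. 3.5. [MeierSchirmerZupan2016]
* M. Kervaire, J. Milnor, *Groups of homotopy spheres I*, Ann. of Math. 77 (1963), §2.
  [KervaireMilnor1963]
-/

noncomputable section

open scoped Manifold ContDiff Topology
open Set

namespace Literature.Topology.FourManifolds

universe u v

namespace Trisection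

section Essential

variable {X : Type u} [TopologicalSpace X] [ChartedSpace (EuclideanSpace ℝ (Fin 4)) X]
  [IsManifold (𝓡 4) ∞ X]
  {X' : Type v} [TopologicalSpace X'] [ChartedSpace (EuclideanSpace ℝ (Fin 4)) X']
  [IsManifold (𝓡 4) ∞ X']

/-- **Essential curves stay essential under diffeomorphisms**: if no smoothly embedded disc
inside `Σ` bounds `δ`, then no smoothly embedded disc inside `Φ(Σ)` bounds `Φ(δ)` (pull a disc
back along `Φ⁻¹`).  This is the essentiality clause of the reducing curves of
`isConnectedSum_of_reducing_separating` / `…_circleProd_of_reducing_nonseparating` /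
`IsReducible`. [cite: ArandaZupan2025, §2 (p. 6)] -/
theorem not_exists_disc_image_diffeomorph {S : Fin 3 → Set X} {δ : Set X}
    (hess : ¬ ∃ e : Metric.closedBall (0 : EuclideanSpace ℝ (Fin 2)) 1 → X,
      Manifold.IsSmoothEmbedding (𝓡∂ 2) (𝓡 4) ∞ e ∧ range e ⊆ centralSurfaceSet S ∧
        e '' (𝓡∂ 2).boundary (Metric.closedBall (0 : EuclideanSpace ℝ (Fin 2)) 1) = δ)
    (Φ : X ≃ₘ⟮𝓡 4, 𝓡 4⟯ X') :
    ¬ ∃ e : Metric.closedBall (0 : EuclideanSpace ℝ (Fin 2)) 1 → X',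
      Manifold.IsSmoothEmbedding (𝓡∂ 2) (𝓡 4) ∞ e ∧
        range e ⊆ centralSurfaceSet (fun i => Φ '' S i) ∧
        e '' (𝓡∂ 2).boundary (Metric.closedBall (0 : EuclideanSpace ℝ (Fin 2)) 1) = Φ '' δ := by
  rintro ⟨e, he, heF, heb⟩
  refine hess ⟨Φ.symm ∘ e, he.diffeomorph_comp Φ.symm, ?_, ?_⟩
  · rw [range_comp]
    rw [centralSurfaceSet_image S (EquivLike.bijective Φ)] at heF
    calc Φ.symm '' range e ⊆ Φ.symm '' (Φ '' centralSurfaceSet S) := image_mono heF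
      _ = centralSurfaceSet S := Φ.symm_image_image _
  · rw [image_comp, heb, Φ.symm_image_image]

end Essential

/-! ### The separating case across universes -/

/-- **`isConnectedSum_of_reducing_separating` at one universe gives it at every universe**
(PROVED).  Move `X : Type u` with its trisection, reducing curve, essentiality, compressing discs
and separation to `Shrink.{v} X` (`ManifoldShrink.lean`, `IsGKTrisection.preimage_diffeomorph`,
`WeaklyReducibleTrisectionsNaturality.lean`), split there, move the two summands `Xᵢ : Type v`
to `Shrink.{u} Xᵢ : Type u` with their trisections, and carry `Shrink X = X₁ # X₂` along the
three diffeomorphisms (`IsConnectedSum.of_diffeomorph`, `…_left`, `…_right`).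
[cite: ArandaZupan2025, §2 p. 6 (reducing curves, separating case)] [cite: KervaireMilnor1963, §2] -/
theorem isConnectedSum_of_reducing_separating_of_univ
    (h : isConnectedSum_of_reducing_separating.{v}) :
    isConnectedSum_of_reducing_separating.{u} := by
  intro X _ _ _ _ _ _ _ o g k S δ hT hc hess hd hsep
  haveI : Small.{v} X := small_of_secondCountableTopology X
  let ψ : Shrink.{v} X ≃ₘ⟮𝓡 4, 𝓡 4⟯ X := ManifoldShrink.diffeomorph (𝓡 4) X ∞
  have hinj : Function.Injective ψ.symm := EquivLike.injective ψ.symm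
  have hT' : IsGKTrisection (Shrink.{v} X) g k (fun i => ψ.symm '' S i) := by
    simpa only [Diffeomorph.symm_image_eq_preimage] using hT.preimage_diffeomorph ψ
  have hd' : ∀ q : Fin 3, BoundsDisc (fun i => ψ.symm '' S i)
      (spineHandlebody (fun i => ψ.symm '' S i) q) (ψ.symm '' δ) := fun q => by
    rw [spineHandlebody_image S hinj]
    exact (hd q).image_diffeomorph ψ.symm
  have hsep' : ¬ IsNonSeparating (fun i => ψ.symm '' S i) (ψ.symm '' δ) := fun h' =>
    hsep ((isNonSeparating_image_homeomorph_iff S δ ψ.symm.toHomeomorph).1 h')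
  obtain ⟨X₁, _, _, _, _, _, _, _, X₂, _, _, _, _, _, _, _, g₁, g₂, k₁, k₂, S₁, S₂, hT₁, hT₂,
    hg, hg₁, hg₂, hk, hP⟩ := h (Shrink.{v} X) (ManifoldShrink.orientation o) g k _ _ hT'
      (hc.image_diffeomorph ψ.symm) (not_exists_disc_image_diffeomorph hess ψ.symm) hd' hsep'
  haveI : Small.{u} X₁ := small_of_secondCountableTopology X₁
  haveI : Small.{u} X₂ := small_of_secondCountableTopology X₂
  let ψ₁ : Shrink.{u} X₁ ≃ₘ⟮𝓡 4, 𝓡 4⟯ X₁ := ManifoldShrink.diffeomorph (𝓡 4) X₁ ∞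
  let ψ₂ : Shrink.{u} X₂ ≃ₘ⟮𝓡 4, 𝓡 4⟯ X₂ := ManifoldShrink.diffeomorph (𝓡 4) X₂ ∞
  refine ⟨Shrink.{u} X₁, inferInstance, inferInstance, inferInstance, inferInstance, inferInstance,
    inferInstance, inferInstance, Shrink.{u} X₂, inferInstance, inferInstance, inferInstance,
    inferInstance, inferInstance, inferInstance, inferInstance, g₁, g₂, k₁, k₂,
    (fun i => ψ₁ ⁻¹' S₁ i), (fun i => ψ₂ ⁻¹' S₂ i), hT₁.preimage_diffeomorph ψ₁,
    hT₂.preimage_diffeomorph ψ₂, hg, hg₁, hg₂, hk, ?_⟩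
  exact ((hP.of_diffeomorph ψ).of_diffeomorph_left ψ₁.symm).of_diffeomorph_right ψ₂.symm

/-- `isConnectedSum_of_reducing_separating` does not depend on the universe.
[cite: ArandaZupan2025, §2 p. 6 (reducing curves, separating case)] -/
theorem isConnectedSum_of_reducing_separating_univ_iff :
    isConnectedSum_of_reducing_separating.{u} ↔ isConnectedSum_of_reducing_separating.{v} :=
  ⟨isConnectedSum_of_reducing_separating_of_univ, isConnectedSum_of_reducing_separating_of_univ⟩

/-! ### The non-separating case across universes -/

/-- **`isConnectedSum_circleProd_of_reducing_nonseparating` at one universe gives it at every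
universe** (PROVED, same transport; the summand `S¹ × S³ = Circle × 𝕊³ : Type` is fixed and only
the glued manifold and the summand `X₁` move).
[cite: ArandaZupan2025, §2 p. 6 (reducing curves, non-separating case)] [cite: KervaireMilnor1963, §2] -/
theorem isConnectedSum_circleProd_of_reducing_nonseparating_of_univ
    (h : isConnectedSum_circleProd_of_reducing_nonseparating.{v}) :
    isConnectedSum_circleProd_of_reducing_nonseparating.{u} := by
  intro X _ _ _ _ _ _ _ o g k S δ hT hc hess hd hns
  haveI : Small.{v} X := small_of_secondCountableTopology X
  let ψ : Shrink.{v} X ≃ₘ⟮𝓡 4, 𝓡 4⟯ X := ManifoldShrink.diffeomorph (𝓡 4) X ∞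
  have hinj : Function.Injective ψ.symm := EquivLike.injective ψ.symm
  have hT' : IsGKTrisection (Shrink.{v} X) g k (fun i => ψ.symm '' S i) := by
    simpa only [Diffeomorph.symm_image_eq_preimage] using hT.preimage_diffeomorph ψ
  have hd' : ∀ q : Fin 3, BoundsDisc (fun i => ψ.symm '' S i)
      (spineHandlebody (fun i => ψ.symm '' S i) q) (ψ.symm '' δ) := fun q => by
    rw [spineHandlebody_image S hinj]
    exact (hd q).image_diffeomorph ψ.symm
  obtain ⟨X₁, _, _, _, _, _, _, _, g₁, k₁, S₁, hT₁, hg, hk, hP⟩ :=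
    h (Shrink.{v} X) (ManifoldShrink.orientation o) g k _ _ hT' (hc.image_diffeomorph ψ.symm)
      (not_exists_disc_image_diffeomorph hess ψ.symm) hd'
      (hns.image_homeomorph ψ.symm.toHomeomorph)
  haveI : Small.{u} X₁ := small_of_secondCountableTopology X₁
  let ψ₁ : Shrink.{u} X₁ ≃ₘ⟮𝓡 4, 𝓡 4⟯ X₁ := ManifoldShrink.diffeomorph (𝓡 4) X₁ ∞
  refine ⟨Shrink.{u} X₁, inferInstance, inferInstance, inferInstance, inferInstance, inferInstance,
    inferInstance, inferInstance, g₁, k₁, (fun i => ψ₁ ⁻¹' S₁ i),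
    hT₁.preimage_diffeomorph ψ₁, hg, hk, ?_⟩
  exact (hP.of_diffeomorph ψ).of_diffeomorph_left ψ₁.symm

/-- `isConnectedSum_circleProd_of_reducing_nonseparating` does not depend on the universe.
[cite: ArandaZupan2025, §2 p. 6 (reducing curves, non-separating case)] -/
theorem isConnectedSum_circleProd_of_reducing_nonseparating_univ_iff :
    isConnectedSum_circleProd_of_reducing_nonseparating.{u} ↔
      isConnectedSum_circleProd_of_reducing_nonseparating.{v} :=
  ⟨isConnectedSum_circleProd_of_reducing_nonseparating_of_univ,
    isConnectedSum_circleProd_of_reducing_nonseparating_of_univ⟩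

end Trisection

end Literature.Topology.FourManifolds

end
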